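import Summits.QuantumFields.YangMills.Theses.SqueezedSkewness

/-!
# Birth skeleton for `SqueezedSkewness.LowPassFloorH` (rev 11 item stmt-QuantumFields-23201; planner ym-idea-6 g10, LINE β «vacuum row»)

`LowPassFloorH_of : LowPassFloor → ThermalFraction → LowPassFloorH` — the hypercube low-pass floor from the ZERO-TEMPERATURE
(period-doubled cylinder) floor `LowPassFloor` (existing item stmt-QuantumFields-22794, stub BY NAME) and the route item
`ThermalFraction` (rev 13, BY NAME as `stub_thermalFraction`, «THERMAL FRACTION»): in the floor unit, the hypercube low-pass mirror correlator is at least a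
fixed fraction `c₀` of its cylinder values for all large `k` (up to any `δ > 0`).

MECHANISM (why ThermalFraction is true; no summit / NT statement is proved here): by the finite-period Källén–Lehmann form
(`TorusKL`, item 23204, and its `T → ∞` limit) `M_T(t,t) = Σ_(i,j),lp p_i μ_ij² |c_ij|² μ_ij^(2(t−1))` with `p_i = λ_i^T/Z_T`; the
VACUUM ROW `i = 0` alone is `p₀(T) · M_∞(t,t)` (λ₀ is the top eigenvalue, so the row has no image atoms and its amplitudes are the
zero-temperature ones), every other term is `≥ 0`, hence `M_T ≥ p₀(T) · M_∞ = p₀(T) · lim_k M_(2^k T)`.  So ThermalFraction is the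
VACUUM-FRACTION floor `p₀(2L+1) ≥ c₀ > 0` on hypercubes of physical size `≥ Λ₆` in the floor unit: `ln(1/p₀) = ` (free energy of
the hypercube relative to the vacuum energy) `= O(Λ⁴ · pressure(1/Λ))` — `→ 0` for a glueball gas and `O(1)` even for a massless
one (Stefan–Boltzmann / hyperscaling); strictly WEAKER than purity `Z_2T/Z_T² → 1` (HypercubePurity 26514, aside).  It is an
infrared statement (no convergent expansion at weak coupling); recorded as the alternative decomposition of `LowPassFloorH`
(which stays directly claimable and is the binder of `closes`). -/

set_option autoImplicit false

namespace Summit.QuantumFields.YangMills.Cruxes.NT.LowPassFloorHBirth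

open Summit.QuantumFields.YangMills.Theses.SqueezedSkewness

namespace __Registered

/-- Statement of `stub_lowPassFloorCyl` = the route item `LowPassFloor` (stmt-QuantumFields-22794) BY NAME: low-pass mirror
floor `ε·a⁸ ≤ M` at physical separation 5 on the period-doubled cylinders `(2L+1)³ × 2^k(2L+1)`, `k ≥ k₀(β, L)`. -/
abbrev stub_lowPassFloorCyl : Prop := LowPassFloor

/-- Statement of `stub_thermalFraction` («ThermalFraction», NEW, infrared, size L/XL): in a unit carrying the cylinder floor of
`LowPassFloor`, there are `c₀ > 0`, `β₆`, `Λ₆` with `c₀ · M β (2L+1) (2^k(2L+1)) a t ≤ M β (2L+1) (2L+1) a t + δ` for every `δ > 0`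
and all large `k`, `t = ⌊5/(2a)⌋+1`, whenever `β ≥ β₆`, `a(β)·L ≥ Λ₆` (vacuum fraction `p₀ ≥ c₀` of the hypercube thermal state). -/
abbrev stub_thermalFraction : Prop := ThermalFraction

end __Registered

/-! ## The two registered stubs — the ONLY `sorry`s of this file -/

/-- stub: the cylinder floor = route item `LowPassFloor` (XL, clause-(i) wall at zero temperature). -/
theorem stub_lowPassFloorCyl : __Registered.stub_lowPassFloorCyl := by
  sorry

/-- stub: ThermalFraction (infrared; vacuum fraction of the hypercube). -/
theorem stub_thermalFraction : __Registered.stub_thermalFraction := by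
  sorry

/-! ## Composition (no `sorry` below): the crux BY NAME -/

/-- **LowPassFloorH_of** — `LowPassFloor → ThermalFraction → LowPassFloorH` with `ε' = c₀·ε`, `β₅' = max β₅ β₆`, `Λ₅' = max Λ₅ Λ₆`. -/
theorem LowPassFloorH_of (h1 : __Registered.stub_lowPassFloorCyl)
    (h2 : __Registered.stub_thermalFraction) :
    LowPassFloorH := by
  intro G _ _ _ _ hG
  obtain ⟨r, a, hra⟩ := h1 G hG
  refine ⟨r, a, ?_⟩
  intro St Cfg P A w E Cov refl
  obtain ⟨ha, ha0, hfl⟩ := hra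
  refine ⟨ha, ha0, ?_⟩
  intro lp κ Bc ind kap M
  obtain ⟨ε, β₅, Λ₅, hε, hfl⟩ := hfl
  obtain ⟨c₀, β₆, Λ₆, hc₀, htf⟩ := h2 G hG r a ⟨ε, β₅, Λ₅, hε, hfl⟩
  refine ⟨c₀ * ε, max β₅ β₆, max Λ₅ Λ₆, mul_pos hc₀ hε, fun β hβ L hL => ?_⟩
  obtain ⟨k₀, hk⟩ := hfl β (le_of_max_le_left hβ) L ((le_max_left _ _).trans hL)
  have htf' := htf β (le_of_max_le_right hβ) L ((le_max_right _ _).trans hL)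
  refine le_of_forall_pos_le_add fun δ hδ => ?_
  obtain ⟨k, hk1, hk2⟩ := ((htf' δ hδ).and (Filter.eventually_ge_atTop k₀)).exists
  calc c₀ * ε * a β ^ 8 = c₀ * (ε * a β ^ 8) := by ring
    _ ≤ c₀ * M β (2 * L + 1) (2 ^ k * (2 * L + 1)) (a β) (Nat.floor (5 / (2 * a β)) + 1) :=
        mul_le_mul_of_nonneg_left (hk k hk2) hc₀.le
    _ ≤ M β (2 * L + 1) (2 * L + 1) (a β) (Nat.floor (5 / (2 * a β)) + 1) + δ := hk1

end Summit.QuantumFields.YangMills.Cruxes.NT.LowPassFloorHBirth
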